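import Summits.ResolutionOfSingularities.ResolutionOfSingularities.Theorems.DeltaCutAdapted
import HarnessLib

/-!
# DeltaCutLaw2 — decomp-res node «DeltaCut» (lens-6 g23, critic row 181 CLEARED DECIDED +1 · MAP +1 (lane (b))),
tree file 4/8 of the node

Content VERBATIM from the decomp-res lens-6 g23 node `HOME/decomp-res-lens-6/g23/DeltaCut.lean` (pin a85f83d5) /
`DeltaCutJ.lean` (9b3a0295); imports the
landed tree only, carries nothing; HOME = run/shared/lean/pub/decomp-res; critic row 181 CLEARED DECIDED +1 · MAP +1
(lane (b)); landing orders NODE-g23.md §10 /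
INBOX :883 — provenance, critic text and the lens header in full in the first file of the node, `DeltaCutLaw`.
Namespace `…Theorems.DeltaCutClasses`;
`--supports stmt-ResolutionOfSingularities-26971`; cone-free.

## This file

§SchemeLaw — THE LAW AT SCHEME LEVEL, BOTH DIRECTIONS (kernel): `not_near_of_delta_light` (`π` a blow-up of regular `X` along a regular centre supported at the closed point `x = π(y)`; if for EVERY chart and EVERY prime SOME `f ∈ 𝓘_x` has SOME adapted presentation with SOME light layer, then `𝓘'_y ⊄ 𝔫^n`), `exists_near_of_delta_heavy` (conversely the point `y'` of a prime at which EVERY `f ∈ 𝓘_x` is heavy in EVERY adapted presentation at EVERY layer is NEAR: `𝓘'_{y'} ≤ 𝔫^n`); §Predicate — THE PREDICATE at IDEAL level `IsDeltaLight n J` (`∃ c s̄, ∀ i 𝔮 prime, ∃ f ∈ J, ∃ (E,b) adapted presentation, ∃ k < n light`), `DeltaLightAt 𝓘 n y := IsDeltaLight n 𝓘_y`, `noNearPointOver_of_deltaLightAt`; §TransportN `deltaLight_transport`; §OffCentreN `deltaLightAt_transform_iff_of_not_mem` ⇒ `nearPointFree_deltaLight`, `nearPointFree_splitOrLightOrDeltaLight`;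 §Closing — generic engine `wor_of_nearPointFree` (ANY near-point-free predicate holding on the wild set closes weak resolution from `OrderUSC`, `BaseStable`, `WORAllAbs n` via the tree's `wildElimination_of_nearPointFree`), `wor_of_splitOrLightOrDeltaLight` (continued `…B` where the cap cuts).  (This first part carries: `not_near_of_delta_light`, `exists_near_of_delta_heavy`, `IsDeltaLight`, `DeltaLightAt`, `noNearPointOver_of_deltaLightAt`, `deltaLight_transport`, `deltaLightAt_transform_iff_of_not_mem`, `nearPointFree_deltaLight`.)

[WRITER NOTE (decomp-res writer g11): file split only (tree files ≤ 400 lines); `noncomputable section`, universe,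
namespace, sections, section
variables, the `open` lines and every declaration exactly as in the lens; no instance, no notation, no include/omit added.]

(Sources: Hironaka1967 (characteristic polyhedra); CossartJannsenSaito2020 Def. 3.13 / Thm. 3.14 p. 129, Ch. 8 pp.
128–135, Thm. 9.6 p. 136; Hironaka1970 (near points / vertices); CossartPiltant2008 §2; Giraud1975; EGAIV4 §16–§17
(formal smoothness); StacksProject 0804 / 0BIQ / 031I; Matsumura1987 §28.)
-/

noncomputable section

open CategoryTheory CategoryTheory.Limits AlgebraicGeometry TopologicalSpace IsLocalRing
open Literature.AlgebraicGeometry.Resolution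
universe u

open Summit.ResolutionOfSingularities.ResolutionOfSingularities.Theorems.TwistCutClasses
open Summit.ResolutionOfSingularities.ResolutionOfSingularities.Theorems.LightCutClasses

namespace Summit.ResolutionOfSingularities.ResolutionOfSingularities.Theorems.DeltaCutClasses

section SchemeLaw

variable {X X' : Scheme.{u}} {π : X' ⟶ X} {C : X.IdealSheafData}

/-! ### THE δ-LAW AT SCHEME LEVEL, BOTH DIRECTIONS: «δ-light ⟹ no near point» and «δ-heavy for the whole stalk ideal
⟹ a near point EXISTS» -/

/-- **THE δ-LAW (kernel, scheme level; direction «light ⟹ not near»; every characteristic, every field, every `n ≥ 1`).**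
Blow-up `π : X' → X` of the regular `X` along a regular centre supported at the closed point `x = π y`; `c` a regular system of
parameters at `x`; `s̄ : κ(x) →+* 𝒪_x/𝔪_x^n` a ring section with adapted lifts.  Suppose the stalk `𝓘_x` is δ-LIGHT in the
IDEAL-LEVEL sense: for every chart `i` and every prime `𝔮` of `κ(x)[T_j : j ≠ i]` SOME `f ∈ 𝓘_x` with SOME adapted layered
presentation `f ≡ Σ_{k<n} Σ_{e ∈ E_k} b_{k,e} c^e (mod 𝔪_x^{2n})` has SOME layer `k < n` with `s·Ḡ_k ∉ 𝔮^{n-k}` for all `s ∉ 𝔮`.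
Then `y` is NOT a near point: `𝓘'_y ⊄ 𝔪_y^n` for `𝓘' = (π^*𝓘 : 𝓔^n)` (the chart prime of `y` is tested against its own `f`).
[new] (Sources: CossartJannsenSaito2020, Thm 9.6; Giraud1975; CossartPiltant2008, §2.) -/
theorem not_near_of_delta_light (hπ : IsBlowup π C) (hX : Scheme.IsRegular X) (hCreg : Scheme.IsRegular C.subscheme)
    (I : X.IdealSheafData) (y : X') (hcl : IsClosed ({π.base y} : Set X)) (hpt : (C.support : Set X) = {π.base y})
    {d : ℕ} (c : Fin d → X.presheaf.stalk (π.base y)) (hd : (maximalIdeal (X.presheaf.stalk (π.base y))).spanFinrank = d)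
    (hc : Ideal.span (Set.range c) = maximalIdeal (X.presheaf.stalk (π.base y)))
    {n : ℕ} (hn : 1 ≤ n)
    (sbar : ResidueField (X.presheaf.stalk (π.base y)) →+*
      X.presheaf.stalk (π.base y) ⧸ (maximalIdeal (X.presheaf.stalk (π.base y))) ^ n)
    (hsbar : ∀ β, ∃ r, Ideal.Quotient.mk ((maximalIdeal (X.presheaf.stalk (π.base y))) ^ n) r = sbar β ∧
      residue (X.presheaf.stalk (π.base y)) r = β)
    (hδ : ∀ (i : Fin d) (𝔮 : Ideal (MvPolynomial {j : Fin d // j ≠ i} (ResidueField (X.presheaf.stalk (π.base y))))),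
      𝔮.IsPrime → ∃ f ∈ stalkIdeal I (π.base y), ∃ (E : ℕ → Finset (Fin d → ℕ))
        (b : ℕ → (Fin d → ℕ) → X.presheaf.stalk (π.base y)),
        (∀ k, ∀ e ∈ E k, ∑ j, e j = n + k) ∧
        (∀ k e, Ideal.Quotient.mk ((maximalIdeal (X.presheaf.stalk (π.base y))) ^ n) (b k e) =
          sbar (residue (X.presheaf.stalk (π.base y)) (b k e))) ∧
        f - ∑ k ∈ Finset.range n, ∑ e ∈ E k, b k e * ∏ j, c j ^ e j ∈
          maximalIdeal (X.presheaf.stalk (π.base y)) ^ (n + n) ∧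
        ∃ k, k < n ∧ ∀ s ∉ 𝔮, s * (∑ e ∈ E k, MvPolynomial.monomial (restrictExp i e) (residue _ (b k e))) ∉ 𝔮 ^ (n - k)) :
    ¬ stalkIdeal (controlledTransform π C I n) y ≤ maximalIdeal (X'.presheaf.stalk y) ^ n := by
  classical
  intro hle
  haveI : IsRegularLocalRing (X.presheaf.stalk (π.base y)) := hX _
  have hqr : IsQuasiRegular c := isQuasiRegular_rsop_comp hd c hc id Function.injective_id
  -- the centre stalk is `𝔪_x`
  have hCst : stalkIdeal C (π.base y) = maximalIdeal _ := by
    rw [eq_vanishingIdeal_support_of_isRegular C hCreg]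
    apply stalkIdeal_vanishingIdeal_eq_maximalIdeal_of_closure_eq
    rw [hpt, hcl.closure_eq]
  have hcC : Ideal.span (Set.range c) = stalkIdeal C (π.base y) := hc.trans hCst.symm
  -- the chart at `y`
  obtain ⟨i, 𝔴, χ, hχ, hloc, h𝔴⟩ := hπ.exists_reesChart_stalk y c hcC
  have hg : ∀ j, chartBase c i (c j) = chartBase c i (c i) * chartGen c i j := fun j =>
    reesChartBase_apply_eq_mul_chartGen c i j
  have hK𝔴 : chartBase c i (c i) ∈ 𝔴.asIdeal := by
    rw [← Ideal.mem_comap, h𝔴, ← hc]; exact Ideal.subset_span ⟨i, rfl⟩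
  haveI := map_rho_isPrime c i hc hqr 𝔴.asIdeal hK𝔴
  -- `E_y = (t)`, `t = π^* cᵢ`
  have hE𝔷 : stalkIdeal (C.comap π) y = Ideal.span {(π.stalkMap y).hom (c i)} := by
    rw [stalkIdeal_comap_eq_map_stalkMap, hCst, ← hc, Ideal.map_span]
    apply le_antisymm
    · rw [Ideal.span_le]
      rintro _ ⟨_, ⟨j, rfl⟩, rfl⟩
      change (π.stalkMap y).hom (c j) ∈ Ideal.span {(π.stalkMap y).hom (c i)}
      rw [← hχ (c j), hg j, map_mul, hχ]
      exact Ideal.mul_mem_right _ _ (Ideal.mem_span_singleton_self _)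
    · rw [Ideal.span_singleton_le_iff_mem]
      exact Ideal.subset_span ⟨c i, ⟨i, rfl⟩, rfl⟩
  -- colon formula for the controlled transform
  have hI' : stalkIdeal (controlledTransform π C I n) y =
      Submodule.colon ((stalkIdeal I (π.base y)).map (π.stalkMap y).hom) {(π.stalkMap y).hom (c i) ^ n} := by
    rw [hπ.stalkIdeal_controlledTransform I n y, stalkIdeal_comap_eq_map_stalkMap, hE𝔷, Ideal.span_singleton_pow,
      Submodule.colon_span]
  -- the element tested at the chart prime of `y`, its layered chart expansion in `𝒪_y`
  obtain ⟨f, hfI, E, b, hE, hb, hfa, k, hkn, hlight⟩ := hδ i (𝔴.asIdeal.map (rho c i hc hqr)) inferInstance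
  have hfa' : f - ∑ k ∈ Finset.range n, ∑ e ∈ E k, b k e * ∏ j, c j ^ e j ∈ Ideal.span (Set.range c) ^ (n + n) := by
    rw [hc]; exact hfa
  obtain ⟨bn, hσf⟩ := chart_expansion_layers c i (π.stalkMap y).hom χ hχ E hE b hfa'
  -- nearness: `w ∈ 𝓘'_y ⊆ 𝔪_y^n`, `σ f = t^n w`
  have hwI : ∑ k ∈ Finset.range n, (π.stalkMap y).hom (c i) ^ k *
      χ (∑ e ∈ E k, chartBase c i (b k e) * monProd (fun j : {j : Fin d // j ≠ i} => chartGen c i j.1) (fun j => e j.1)) +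
        (π.stalkMap y).hom (c i) ^ n * χ bn ∈ stalkIdeal (controlledTransform π C I n) y := by
    rw [hI', Submodule.mem_colon_singleton, smul_eq_mul, mul_comm, ← hσf]
    exact Ideal.mem_map_of_mem _ hfI
  exact delta_law_at c i hd hc hqr 𝔴.asIdeal h𝔴 (X'.presheaf.stalk y) (π.stalkMap y).hom χ hχ hloc hn sbar hsbar E b hb
    ⟨k, hkn, hlight⟩ bn (hle hwI)

set_option maxHeartbeats 800000 in
/-- **THE CONVERSE δ-LAW (kernel, scheme level; direction «heavy ⟹ near»; exactness of the re-location).**  Same setting, with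
`𝓘_x ⊆ 𝔪_x^n`.  If in some chart `i` some prime `𝔮` of `κ(x)[T_j : j ≠ i]` is δ-HEAVY FOR THE WHOLE STALK IDEAL — for EVERY
`f ∈ 𝓘_x` and EVERY adapted layered presentation of `f`, EVERY layer `k < n` has `s_k·Ḡ_k ∈ 𝔮^{n-k}` for some `s_k ∉ 𝔮` — then
the point `y ∈ X'` of the blowing up centred at `ρ⁻¹(𝔮)` (`exists_point_of_reesChart_prime`) lies over `x` and IS a near point:
`𝓘'_y ⊆ 𝔪_y^n`.  (`𝓘_x·𝒪_y ⊆ (t^n)·𝔪_y^n` elementwise by `transform_mem_pow_of_delta_heavy`, adapted presentations existing for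
every `f ∈ 𝔪_x^n` by `exists_adapted_layers`; then cancel `t^n` in the domain `𝒪_y`.)  With `not_near_of_delta_light`:
«a near point over `x` exists» ⟺ «`𝓘_x` is not δ-light» — Hironaka's near-point criterion `δ ≥ 1`, for IDEALS, at the level of
`controlledTransform`. [new] (Sources: CossartJannsenSaito2020, Thm 9.6; Giraud1975.) -/
theorem exists_near_of_delta_heavy (hπ : IsBlowup π C) (hX : Scheme.IsRegular X) (hCreg : Scheme.IsRegular C.subscheme)
    (I : X.IdealSheafData) (x : X) (hcl : IsClosed ({x} : Set X)) (hpt : (C.support : Set X) = {x})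
    {d : ℕ} (c : Fin d → X.presheaf.stalk x) (hd : (maximalIdeal (X.presheaf.stalk x)).spanFinrank = d)
    (hc : Ideal.span (Set.range c) = maximalIdeal (X.presheaf.stalk x))
    {n : ℕ} (hn : 1 ≤ n) (hIn : stalkIdeal I x ≤ maximalIdeal (X.presheaf.stalk x) ^ n)
    (sbar : ResidueField (X.presheaf.stalk x) →+* X.presheaf.stalk x ⧸ (maximalIdeal (X.presheaf.stalk x)) ^ n)
    (hsbar : ∀ β, ∃ r, Ideal.Quotient.mk ((maximalIdeal (X.presheaf.stalk x)) ^ n) r = sbar β ∧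
      residue (X.presheaf.stalk x) r = β)
    {i : Fin d} (𝔮 : Ideal (MvPolynomial {j : Fin d // j ≠ i} (ResidueField (X.presheaf.stalk x)))) [𝔮.IsPrime]
    (hheavy : ∀ f ∈ stalkIdeal I x, ∀ (E : ℕ → Finset (Fin d → ℕ)) (b : ℕ → (Fin d → ℕ) → X.presheaf.stalk x),
      (∀ k, ∀ e ∈ E k, ∑ j, e j = n + k) →
      (∀ k e, Ideal.Quotient.mk ((maximalIdeal (X.presheaf.stalk x)) ^ n) (b k e) =
        sbar (residue (X.presheaf.stalk x) (b k e))) →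
      f - ∑ k ∈ Finset.range n, ∑ e ∈ E k, b k e * ∏ j, c j ^ e j ∈ maximalIdeal (X.presheaf.stalk x) ^ (n + n) →
      ∀ k, k < n → ∃ s ∉ 𝔮, s * (∑ e ∈ E k, MvPolynomial.monomial (restrictExp i e) (residue _ (b k e))) ∈ 𝔮 ^ (n - k)) :
    ∃ y : X', π.base y = x ∧ stalkIdeal (controlledTransform π C I n) y ≤ maximalIdeal (X'.presheaf.stalk y) ^ n := by
  classical
  haveI : IsRegularLocalRing (X.presheaf.stalk x) := hX _
  have hqr : IsQuasiRegular c := isQuasiRegular_rsop_comp hd c hc id Function.injective_id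
  -- the centre stalk is `𝔪_x`
  have hCst : stalkIdeal C x = maximalIdeal _ := by
    rw [eq_vanishingIdeal_support_of_isRegular C hCreg]
    apply stalkIdeal_vanishingIdeal_eq_maximalIdeal_of_closure_eq
    rw [hpt, hcl.closure_eq]
  have hcC : Ideal.span (Set.range c) = stalkIdeal C x := hc.trans hCst.symm
  -- the chart prime `𝔴₀ = ρ⁻¹(𝔮) ∋ cᵢ` over `𝔪_x`, with `ρ(𝔴₀) = 𝔮`
  haveI h𝔴₀p : (𝔮.comap (rho c i hc hqr)).IsPrime := Ideal.comap_isPrime _ _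
  have h𝔴₀ : (𝔮.comap (rho c i hc hqr)).comap (chartBase c i) = maximalIdeal _ := by
    ext r
    rw [Ideal.mem_comap, Ideal.mem_comap, rho_base]
    constructor
    · intro h
      by_contra hr
      have hu : IsUnit r := by
        by_contra hnu
        exact hr ((IsLocalRing.mem_maximalIdeal r).2 (mem_nonunits_iff.2 hnu))
      exact (Ideal.IsPrime.ne_top inferInstance)
        (Ideal.eq_top_of_isUnit_mem _ h ((hu.map (residue _)).map MvPolynomial.C))
    · intro hr
      rw [(residue_eq_zero_iff r).2 hr, map_zero]
      exact zero_mem _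
  have h𝔮eq : (𝔮.comap (rho c i hc hqr)).map (rho c i hc hqr) = 𝔮 :=
    Ideal.map_comap_of_surjective _ (rho_surjective c i hc hqr) 𝔮
  -- THE POINT of `X'` centred at `𝔴₀`
  obtain ⟨y, hy, χ, hχ, hloc⟩ := exists_point_of_reesChart_prime hπ x c hcC i ⟨_, h𝔴₀p⟩ h𝔴₀
  subst hy
  have hχ' : ∀ r, χ (chartBase c i r) = (π.stalkMap y).hom r := fun r => by
    have h := hχ r
    rwa [TopCat.Presheaf.stalkCongr_hom, stalkSpecializes_self_apply] at h
  refine ⟨y, rfl, ?_⟩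
  letI alg : Algebra (chartRing c i) (X'.presheaf.stalk y) := χ.toAlgebra
  haveI : IsLocalization.AtPrime (X'.presheaf.stalk y) (𝔮.comap (rho c i hc hqr)) := hloc
  have halg : ∀ w, algebraMap (chartRing c i) (X'.presheaf.stalk y) w = χ w := fun w => by
    rw [RingHom.algebraMap_toAlgebra]
  -- `𝒪_y` is regular (hence a domain) and `t = π♯ cᵢ ≠ 0` (Literature `isRsopPart_chartFamily_reesChart`)
  have hz : Ideal.span (Set.range (Fin.append c (Fin.elim0 : Fin 0 → X.presheaf.stalk (π.base y)))) = maximalIdeal _ := by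
    have hr : Set.range (Fin.append c (Fin.elim0 : Fin 0 → X.presheaf.stalk (π.base y))) = Set.range c := by
      rw [Fin.append_elim0]
      ext x
      constructor
      · rintro ⟨k, rfl⟩; exact ⟨_, rfl⟩
      · rintro ⟨k, rfl⟩; exact ⟨Fin.cast (Nat.add_zero d).symm k, rfl⟩
    rw [hr]; exact hc
  have hrs := isRsopPart_chartFamily_reesChart c i (Fin.elim0 : Fin 0 → _) hz hd (𝔮.comap (rho c i hc hqr)) h𝔴₀
    (X'.presheaf.stalk y) (a := 0) (fun k => Fin.elim0 k) (Function.injective_of_subsingleton _) fun k => Fin.elim0 k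
  haveI : IsRegularLocalRing (X'.presheaf.stalk y) := hrs.isRegularLocalRing
  haveI := isDomain_of_isRegularLocalRing (X'.presheaf.stalk y)
  have ht2 : (π.stalkMap y).hom (c i) ∉ maximalIdeal (X'.presheaf.stalk y) ^ 2 := by
    have h1 := hrs.not_mem_sq 0
    have h2 : chartFamily c i (Fin.elim0 : Fin 0 → _) (X'.presheaf.stalk y) (chartBase c i) (chartGen c i)
        (fun k => Fin.elim0 k) 0 = (π.stalkMap y).hom (c i) := by
      rw [chartFamily, Fin.cons_zero, halg, hχ']
    rwa [h2] at h1
  have ht0 : (π.stalkMap y).hom (c i) ≠ 0 := fun h0 => ht2 (by rw [h0]; exact zero_mem _)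
  -- `E_y = (t)` and the colon formula for the controlled transform
  have hg : ∀ j, chartBase c i (c j) = chartBase c i (c i) * chartGen c i j := fun j =>
    reesChartBase_apply_eq_mul_chartGen c i j
  have hE𝔷 : stalkIdeal (C.comap π) y = Ideal.span {(π.stalkMap y).hom (c i)} := by
    rw [stalkIdeal_comap_eq_map_stalkMap, hCst, ← hc, Ideal.map_span]
    apply le_antisymm
    · rw [Ideal.span_le]
      rintro _ ⟨_, ⟨j, rfl⟩, rfl⟩
      change (π.stalkMap y).hom (c j) ∈ Ideal.span {(π.stalkMap y).hom (c i)}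
      rw [← hχ' (c j), hg j, map_mul, hχ']
      exact Ideal.mul_mem_right _ _ (Ideal.mem_span_singleton_self _)
    · rw [Ideal.span_singleton_le_iff_mem]
      exact Ideal.subset_span ⟨c i, ⟨i, rfl⟩, rfl⟩
  have hI' : stalkIdeal (controlledTransform π C I n) y =
      Submodule.colon ((stalkIdeal I (π.base y)).map (π.stalkMap y).hom) {(π.stalkMap y).hom (c i) ^ n} := by
    rw [hπ.stalkIdeal_controlledTransform I n y, stalkIdeal_comap_eq_map_stalkMap, hE𝔷, Ideal.span_singleton_pow,
      Submodule.colon_span]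
  -- every `σ f`, `f ∈ 𝓘_x`, is `t^n` times an element of `𝔫^n` (the ring converse, elementwise)
  have hmaple : (stalkIdeal I (π.base y)).map (π.stalkMap y).hom ≤
      Ideal.span {(π.stalkMap y).hom (c i) ^ n} * maximalIdeal (X'.presheaf.stalk y) ^ n := by
    rw [Ideal.map_le_iff_le_comap]
    intro f hf
    rw [Ideal.mem_comap]
    obtain ⟨E, b, hE, hb, hfa⟩ := exists_adapted_layers c hc sbar hsbar f (hIn hf)
    have hfa𝔪 : f - ∑ k ∈ Finset.range n, ∑ e ∈ E k, b k e * ∏ j, c j ^ e j ∈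
        maximalIdeal (X.presheaf.stalk (π.base y)) ^ (n + n) := by
      rw [← hc]; exact hfa
    obtain ⟨bn, hσf⟩ := chart_expansion_layers c i (π.stalkMap y).hom χ hχ' E hE b hfa
    have hheavy' : ∀ k, k < n → ∃ s ∉ (𝔮.comap (rho c i hc hqr)).map (rho c i hc hqr),
        s * (∑ e ∈ E k, MvPolynomial.monomial (restrictExp i e) (residue _ (b k e))) ∈
          ((𝔮.comap (rho c i hc hqr)).map (rho c i hc hqr)) ^ (n - k) := by
      rw [h𝔮eq]; exact hheavy f hf E b hE hb hfa𝔪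
    have hT := transform_mem_pow_of_delta_heavy c i hc hqr (𝔮.comap (rho c i hc hqr)) h𝔴₀ (X'.presheaf.stalk y)
      (π.stalkMap y).hom χ hχ' hloc hn sbar hsbar E b hb hheavy' bn
    rw [hσf]
    exact Ideal.mul_mem_mul (Ideal.mem_span_singleton_self _) hT
  -- cancel `t^n` in the domain `𝒪_y`
  rw [hI']
  intro w hw
  rw [Submodule.mem_colon_singleton, smul_eq_mul] at hw
  obtain ⟨z, hz𝔫, hzw⟩ := Ideal.mem_span_singleton_mul.1 (hmaple hw)
  have hwz : w = z := mul_right_cancel₀ (pow_ne_zero n ht0) (by rw [← hzw, mul_comm])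
  rw [hwz]; exact hz𝔫

end SchemeLaw

section Predicate

/-! ### THE POINT PREDICATE `DeltaLightAt` (IDEAL level), the law at marked-ideal level, transports, `NearPointFree
n (DeltaLightAt · n)` -/

/-- **`IsDeltaLight n J`** (ring level, `A` local; IDEAL-LEVEL δ-lightness — the quantifiers in the ideal order).
For some regular
system of parameters `c` (`|c| = edim A`) and some RING SECTION `s̄ : κ(A) →+* A ⧸ 𝔪^n` with adapted lifts: in EVERY Rees chart
`i` and at EVERY prime `𝔮` of `κ(A)[T_j : j ≠ i]` (= every point of the exceptional divisor in that chart, closed or not), SOME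
`f ∈ J` has SOME adapted layered presentation `f ≡ Σ_{k<n} Σ_{e ∈ E_k} b_{k,e} c^e (mod 𝔪^{2n})` (`|e| = n + k`, all `b_{k,e}`
adapted) with SOME layer `k < n` δ-LIGHT at `𝔮`: `s·Ḡ_k ∉ 𝔮^{n-k}` for all `s ∉ 𝔮` — «no point of the exceptional divisor is
δ-heavy for all of `J`» (Hironaka's `δ < 1` everywhere on `ℙ(Dir)`, read prime by prime; CJS Def. 8.1 / Thm 9.6, tree
`CharPolyhedronDelta`, `CharPolyhedronDeltaPositive.deltaGE_one_pos_iff_forall_mem`, `Hironaka1970NearPointVertices`).  No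
perfectness, no principality: sections exist in every prime characteristic (`exists_ring_section_of_charP`) and
presentations for
every `f ∈ 𝔪^n` (`exists_adapted_layers`).  DEFINITION (support). -/
def IsDeltaLight {A : Type*} [CommRing A] [IsLocalRing A] (n : ℕ) (J : Ideal A) : Prop :=
  ∃ (d : ℕ) (c : Fin d → A), (maximalIdeal A).spanFinrank = d ∧ Ideal.span (Set.range c) = maximalIdeal A ∧
    ∃ sbar : ResidueField A →+* A ⧸ (maximalIdeal A) ^ n,
      (∀ β, ∃ r, Ideal.Quotient.mk ((maximalIdeal A) ^ n) r = sbar β ∧ residue A r = β) ∧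
      ∀ (i : Fin d) (𝔮 : Ideal (MvPolynomial {j : Fin d // j ≠ i} (ResidueField A))), 𝔮.IsPrime →
        ∃ f ∈ J, ∃ (E : ℕ → Finset (Fin d → ℕ)) (b : ℕ → (Fin d → ℕ) → A),
          (∀ k, ∀ e ∈ E k, ∑ j, e j = n + k) ∧
          (∀ k e, Ideal.Quotient.mk ((maximalIdeal A) ^ n) (b k e) = sbar (residue A (b k e))) ∧
          f - ∑ k ∈ Finset.range n, ∑ e ∈ E k, b k e * ∏ j, c j ^ e j ∈ maximalIdeal A ^ (n + n) ∧
          ∃ k, k < n ∧ ∀ s ∉ 𝔮, s * (∑ e ∈ E k, MvPolynomial.monomial (restrictExp i e) (residue A (b k e))) ∉ 𝔮 ^ (n - k)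

/-- **`DeltaLightAt 𝓘 n y`** — the stalk `𝓘_y` is δ-light at marking `n` (ideal level). DEFINITION (support). -/
def DeltaLightAt {Y : Scheme.{0}} (I : Y.IdealSheafData) (n : ℕ) (y : Y) : Prop :=
  IsDeltaLight n (stalkIdeal I y)

open Summit.ResolutionOfSingularities.ResolutionOfSingularities.Theorems
open WeakOrderReduction ForcedTowerClasses SubfieldContactClasses AbsoluteContactClasses PurityValveClasses

/-- **KERNEL: δ-LIGHT ⟹ NO NEAR POINT** at the level of marked ideals (over every point blow-up along a regular centre
supported at the closed point). [new] [folklore] -/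
theorem noNearPointOver_of_deltaLightAt {Y : Scheme.{0}} (hY : Scheme.IsRegular Y) {n : ℕ} (hn : 1 ≤ n)
    (M : MarkedIdeal Y) (hM : M.mult = n) {y : Y} (hyc : IsClosed ({y} : Set Y)) (hl : DeltaLightAt M.ideal n y) :
    NoNearPointOver M y := by
  intro C Y' π hpt hCreg hπ y' hy' hmem
  subst hy'
  obtain ⟨d, c, hd, hc, sbar, hsbar, hδ⟩ := hl
  rw [MarkedIdeal.mem_support_iff, MarkedIdeal.transform_ideal, MarkedIdeal.transform_mult, hM] at hmem
  exact not_near_of_delta_light hπ hY hCreg M.ideal y' hyc hpt c hd hc hn sbar hsbar hδ hmem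

end Predicate

section TransportN

variable {A B : Type*} [CommRing A] [CommRing B] [IsLocalRing A] [IsLocalRing B]

/-- Ring-level δ-LIGHT predicate transported along a ring isomorphism of local rings (the section `s̄` is conjugated by the
induced isomorphisms of residue fields and of `A/𝔪^n`; chart primes are pulled back along `κ(A)[T] ≃ κ(B)[T]`). [folklore] -/
theorem deltaLight_transport (e : A ≃+* B) (n : ℕ) {J : Ideal A} (h : IsDeltaLight n J) : IsDeltaLight n (J.map e) := by
  classical
  obtain ⟨d, c, hd, hc, sbar, hsbar, hδ⟩ := h
  have hpow : (maximalIdeal B) ^ n = ((maximalIdeal A) ^ n).map (e : A →+* B) := by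
    rw [Ideal.map_pow]; exact congrArg (· ^ n) (map_ringEquiv_maximalIdeal e).symm
  let qe : A ⧸ (maximalIdeal A) ^ n ≃+* B ⧸ (maximalIdeal B) ^ n :=
    Ideal.quotientEquiv ((maximalIdeal A) ^ n) ((maximalIdeal B) ^ n) e hpow
  have hqe : ∀ x : A, qe (Ideal.Quotient.mk _ x) = Ideal.Quotient.mk _ (e x) := fun x => rfl
  let sbar' : ResidueField B →+* B ⧸ (maximalIdeal B) ^ n :=
    (qe : _ →+* _).comp (sbar.comp ((residueMapEquiv e).symm : ResidueField B →+* ResidueField A))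
  have hsbar'_apply : ∀ x : A, sbar' (residue B (e x)) = qe (sbar (residue A x)) := by
    intro x
    show qe (sbar ((residueMapEquiv e).symm (residue B (e x)))) = _
    rw [← residueMapEquiv_residue, RingEquiv.symm_apply_apply]
  refine ⟨d, fun j => e (c j), ?_, ?_, sbar', ?_, ?_⟩
  · rw [← map_ringEquiv_maximalIdeal e, Ideal.spanFinrank_map_eq_of_ringEquiv, hd]
  · rw [← map_ringEquiv_maximalIdeal e, ← hc, Ideal.map_span, ← Set.range_comp]; rfl
  · intro β'
    obtain ⟨r, hr1, hr2⟩ := hsbar ((residueMapEquiv e).symm β')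
    have hres : residue B (e r) = β' := by rw [← residueMapEquiv_residue, hr2, RingEquiv.apply_symm_apply]
    refine ⟨e r, ?_, hres⟩
    rw [← hres, hsbar'_apply, hr2, ← hr1, hqe]
  · intro i 𝔮' h𝔮'
    obtain ⟨ρ, hρ⟩ : ∃ ρ : MvPolynomial {j : Fin d // j ≠ i} (ResidueField A) ≃+*
        MvPolynomial {j : Fin d // j ≠ i} (ResidueField B), ρ = MvPolynomial.mapEquiv _ (residueMapEquiv e) := ⟨_, rfl⟩
    have hρG : ∀ (E' : Finset (Fin d → ℕ)) (b' : (Fin d → ℕ) → A),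
        ρ (∑ x ∈ E', MvPolynomial.monomial (restrictExp i x) (residue A (b' x))) =
          ∑ x ∈ E', MvPolynomial.monomial (restrictExp i x) (residue B (e (b' x))) := fun E' b' => by
      rw [hρ]; exact mapEquiv_layer e i E' b'
    obtain ⟨𝔮, h𝔮⟩ : ∃ 𝔮 : Ideal (MvPolynomial {j : Fin d // j ≠ i} (ResidueField A)),
        𝔮 = 𝔮'.map (ρ.symm : _ →+* _) := ⟨_, rfl⟩
    haveI : 𝔮.IsPrime := by rw [h𝔮]; exact Ideal.map_isPrime_of_equiv _
    obtain ⟨f, hfJ, E, b, hE, hb, hfa, k, hkn, hall⟩ := hδ i 𝔮 inferInstance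
    refine ⟨e f, Ideal.mem_map_of_mem _ hfJ, E, fun k x => e (b k x), hE, ?_, ?_, k, hkn, fun s' hs' hmem' => ?_⟩
    · intro k x
      rw [hsbar'_apply, ← hb, hqe]
    · have h1 : e (f - ∑ k ∈ Finset.range n, ∑ x ∈ E k, b k x * ∏ j, c j ^ x j) ∈ (maximalIdeal A ^ (n + n)).map e :=
        Ideal.mem_map_of_mem _ hfa
      rw [Ideal.map_pow, map_ringEquiv_maximalIdeal e] at h1
      simpa [map_sub, map_sum, map_mul, map_prod, map_pow] using h1
    · have hs : ρ.symm s' ∉ 𝔮 := by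
        rw [h𝔮]; exact fun h => hs' ((mem_map_iff_of_equiv ρ.symm _ _).1 h)
      refine hall _ hs ?_
      rw [← ρ.symm_apply_apply (∑ x ∈ E k, _), hρG (E k) (b k), ← map_mul, h𝔮, ← Ideal.map_pow]
      exact (mem_map_iff_of_equiv ρ.symm _ _).2 hmem'

end TransportN

section OffCentreN

open Summit.ResolutionOfSingularities.ResolutionOfSingularities.Theorems
open WeakOrderReduction ForcedTowerClasses SubfieldContactClasses AbsoluteContactClasses PurityValveClasses
variable {Y Y' : Scheme.{0}} {π : Y' ⟶ Y} {C : Y.IdealSheafData}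

/-- OFF-CENTRE INVARIANCE of δ-lightness. [folklore] -/
theorem deltaLightAt_transform_iff_of_not_mem (hπ : IsBlowup π C) (I : Y.IdealSheafData) (b n : ℕ) {y' : Y'}
    (hy : π.base y' ∉ (C.support : Set Y)) :
    DeltaLightAt (controlledTransform π C I b) n y' ↔ DeltaLightAt I n (π.base y') := by
  obtain ⟨e, he⟩ := exists_stalkEquiv_of_not_mem hπ I b hy
  unfold DeltaLightAt
  rw [he]
  refine ⟨fun h => ?_, fun h => deltaLight_transport e n h⟩
  have h' := deltaLight_transport e.symm n h
  rwa [Summit.ResolutionOfSingularities.ResolutionOfSingularities.Theorems.CampaignW46.map_map_symm_of_equiv] at h'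

/-- **`DeltaLightAt · n` is NEAR-POINT-FREE** (the δ-law + off-centre invariance): the tree's generic engine
`wildElimination_of_nearPointFree` / `wildFinite_of_orderUSC'` applies to it VERBATIM. [new] [folklore] -/
theorem nearPointFree_deltaLight {n : ℕ} (hn : 1 ≤ n) : NearPointFree n (fun _ I y => DeltaLightAt I n y) :=
  ⟨fun _ hY M hM _ hyc hs => noNearPointOver_of_deltaLightAt hY hn M hM hyc hs,
    fun _ _ _ _ hπ I b _ hy => deltaLightAt_transform_iff_of_not_mem hπ I b n hy⟩

end OffCentreN

end Summit.ResolutionOfSingularities.ResolutionOfSingularities.Theorems.DeltaCutClasses
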